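import Summits.QuantumFields.YangMills.Theorems.BalabanLadderNTWeakPackageTwoPoint
import Summits.QuantumFields.YangMills.Theorems.BalabanLadderNTWeakPackageThreePointMain
import Summits.QuantumFields.YangMills.Theorems.LangevinControlUVOSLegsAtWeakCouplingCStubLowerI
import Summits.QuantumFields.YangMills.Theses.BalabanLadder
import HarnessLib

/-!
# Crux `NT` (stmt-QuantumFields-19353), stub `stub_cfp : CFP`: `NT` from the WEAK conditional package

Helper file (`--supports stmt-QuantumFields-19353`) of the fleet lead prover of crux `NT` (unit `ym-spine-19353-p1`,
g2).  The registered skeleton v2 «conditional-package» (b5b471720c374849) closes the crux by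
`NT_of := Bridges.nt_of_conditionalPackage stub_cfp`, i.e. through the landed `stub_lower`
(`FBL → FC2 → FC3 → LowerBounds`).  The CONSUMPTION AUDIT of that composition at clause level (sibling files
`…NTWeakPackageTwoPoint`, `…ThreePoint`, `…ThreePointMain`) shows that `stub_lower` uses, of `FC2 G r a` / `FC3 G r a`
(`Theorems/LangevinControlUVOSLegsFromFemtoAndGapDefs.lean` :150 / :161), only:

* (F) a conditional two-point FLOOR `c₂ Γ(‖y−x‖ a) ≤ ‖y−x‖⁸ kerCov (dens x) (dens y)` on femto cubes CENTRED at `x`, for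
  `y − x` in the forward cone `‖y−x‖ < 3 (y−x)₀`, with a shape `Γ` of which only the growth `Γ(s)/s⁸ → ∞` is used
  (no continuity, no upper bound, no `Γ ≤ 1`) and a scale-indexed collar `K` (`s K(s) → 0`);
* (A) a SIGN-FREE clustering bound `|‖u'−u‖⁸ kerCov (dens u) (dens u')| ≤ C₂` for deep pairs of x-centred femto cubes
  at physical separations in `[s₀, ℓ₂]` (the only use of FC2's upper bound, and of its lower bound's sign, in the
  three-point transfer);
* (T) the signed conditional third-cumulant floor of `FC3` on x-centred cubes for triangles based at the centre,
  without `1 ≤ n₃`, continuity or positivity of `Γ₃`;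

together with `FBL G r a` (itself equivalent to its central-site form, `BoundaryLaw.fbl_of_centred`).  This file
assembles the consequence for the crux:

* `lowerBounds_of_weakPackage` — `(∀ β, 0 < a β) → a → 0 → FBL → (F) → (A) → (T) → LowerBounds G r a`;
* `floor_of_fc2`, `abs_of_fc2`, `fc3Weak_of_fc3` — the registered clauses imply the weak ones (so the weak package is
  implied by the body of `CFP`: `lowerBounds_of_cfpBody`);
* `nt_of_weakPackage` — `BalabanLadder.NT` BY NAME from the existence, for one `(r, a)` per compact simple `G`, of the
  weak package `units ∧ FBL ∧ (F) ∧ (A) ∧ (T)` (a candidate v3 re-cut for the owner: strictly fewer engine obligations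
  than `CFP`; not registered here);
* `nt_of_inheritedPackage` — `BalabanLadder.NT` BY NAME from `units ∧ FBL ∧ FC2I ∧ FC3`, the INHERITED two-point package
  of the sibling crux `OSLegsAtWeakCouplingC` (stmt-QuantumFields-16207, line `inherited-amplitude-gates`, landed
  `stub_lowerI`), which makes the same floor/absolute split on all cubes.
-/

set_option autoImplicit false

noncomputable section

open scoped SchwartzMap
open MeasureTheory Filter Topology
open Literature.MathematicalPhysics.QuantumFieldTheory Literature.MathematicalPhysics.QuantumLattice
open Literature.MathematicalPhysics.AQFT Literature.Probability.LatticeModels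
open Summit.QuantumFields.YangMills.Cruxes.OSLegsFromFemtoAndGap.DlrCollarTransfer
open Summit.QuantumFields.YangMills.Cruxes.OSLegsFromFemtoAndGap.DlrCollarTransfer.StubLower (le_depth_cube)
open Summit.QuantumFields.YangMills.Cruxes.OSLegsAtWeakCouplingC.InheritedAmplitudeGates (FC2I stub_lowerI)

namespace Summit.QuantumFields.YangMills.Cruxes.NT.WeakPackage

/-- In the cube of radius `R` centred at `x` every site has depth at most `R + 1` (the depth of the centre). [folklore] -/
theorem depth_centred_le (x y : Fin 4 → ℤ) (R : ℕ) : depth (fun j => x j - R) (2 * R + 1) y ≤ R + 1 := by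
  have h : depth (fun j => x j - R) (2 * R + 1) y ≤
      min (y 0 - (x 0 - R) + 1).toNat ((x 0 - R) + (2 * R + 1 : ℕ) - y 0).toNat := by
    unfold depth
    exact Finset.inf'_le _ (Finset.mem_univ (0 : Fin 4))
  omega

section Lattice

variable (G : Type) [Group G] [TopologicalSpace G] [IsTopologicalGroup G] [CompactSpace G]
  [MeasurableSpace G] [BorelSpace G] (r : LatticeRep G) (a : ℝ → ℝ)

/-- **`LowerBounds` from the weak package**: `FBL`, the weak floor clause (F), the sign-free clustering clause (A) and
the weak third-cumulant clause (T) give the `k`-free lattice lower bounds (the two halves are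
`lowerBounds_twoPoint_weak` and `lowerBounds_threePoint_weak`). [folklore] -/
theorem lowerBounds_of_weakPackage (hapos : ∀ β, 0 < a β) (hlim : Tendsto a atTop (𝓝 0)) (hFBL : FBL G r a)
    (hF : ∃ (Γ : ℝ → ℝ) (β₂ ℓ₂ c₂ : ℝ) (K : ℝ → ℝ) (n₀ : ℕ), 0 < ℓ₂ ∧ 0 < c₂ ∧ (∀ s, 1 ≤ K s) ∧
      Tendsto (fun s : ℝ => s * K s) (nhdsWithin 0 (Set.Ioi 0)) (nhds 0) ∧ 1 ≤ n₀ ∧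
      Tendsto (fun s : ℝ => Γ s / s ^ 8) (nhdsWithin 0 (Set.Ioi 0)) atTop ∧
      ∀ β : ℝ, β₂ ≤ β → ∀ (x : Fin 4 → ℤ) (R : ℕ), ((2 * R + 1 : ℕ) : ℝ) * a β ≤ ℓ₂ →
        ∀ (η : LGConfig 4 G) (y : Fin 4 → ℤ) (s₀ : ℝ), 0 < s₀ → s₀ ≤ ‖siteToE (y - x)‖ * a β →
          (n₀ : ℝ) ≤ ‖siteToE (y - x)‖ → ‖siteToE (y - x)‖ < 3 * siteToE (y - x) 0 →
            K s₀ * ‖siteToE (y - x)‖ ≤ depth (fun j => x j - R) (2 * R + 1) y →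
              c₂ * Γ (‖siteToE (y - x)‖ * a β) ≤
                ‖siteToE (y - x)‖ ^ 8 *
                  kerCov G r β (fun j => x j - R) (2 * R + 1) η (dens G r x) (dens G r y))
    (hA : ∃ (β₂ ℓ₂ C₂ : ℝ) (K : ℝ → ℝ) (n₀ : ℕ), 0 < ℓ₂ ∧ (∀ s, 1 ≤ K s) ∧
      Tendsto (fun s : ℝ => s * K s) (nhdsWithin 0 (Set.Ioi 0)) (nhds 0) ∧ 1 ≤ n₀ ∧
      ∀ β : ℝ, β₂ ≤ β → ∀ (x : Fin 4 → ℤ) (R : ℕ), ((2 * R + 1 : ℕ) : ℝ) * a β ≤ ℓ₂ →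
        ∀ (η : LGConfig 4 G) (u u' : Fin 4 → ℤ) (s₀ : ℝ), 0 < s₀ → s₀ ≤ ‖siteToE (u' - u)‖ * a β →
          ‖siteToE (u' - u)‖ * a β ≤ ℓ₂ → (n₀ : ℝ) ≤ ‖siteToE (u' - u)‖ →
            K s₀ * ‖siteToE (u' - u)‖ ≤ depth (fun j => x j - R) (2 * R + 1) u →
            K s₀ * ‖siteToE (u' - u)‖ ≤ depth (fun j => x j - R) (2 * R + 1) u' →
              |‖siteToE (u' - u)‖ ^ 8 *
                  kerCov G r β (fun j => x j - R) (2 * R + 1) η (dens G r u) (dens G r u')| ≤ C₂)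
    (hT : ∃ (v w : EuclideanSpace ℝ (Fin 4)) (σ δ : ℝ) (Γ₃ : ℝ → ℝ) (β₃ ℓ₃ c₃ : ℝ) (K₃ : ℝ → ℝ) (n₃ : ℕ),
      (σ = 1 ∨ σ = -1) ∧ 0 < δ ∧ 2 * δ < ‖v‖ ∧ 2 * δ < ‖w‖ ∧ 2 * δ < ‖v - w‖ ∧ 0 < ℓ₃ ∧ 0 < c₃ ∧
      (∀ s, 1 ≤ K₃ s) ∧ Tendsto (fun s : ℝ => s * K₃ s) (nhdsWithin 0 (Set.Ioi 0)) (nhds 0) ∧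
      Tendsto (fun s : ℝ => Γ₃ s / s ^ 4) (nhdsWithin 0 (Set.Ioi 0)) atTop ∧
      ∀ β : ℝ, β₃ ≤ β → ∀ (x : Fin 4 → ℤ) (R : ℕ), ((2 * R + 1 : ℕ) : ℝ) * a β ≤ ℓ₃ →
        ∀ (η : LGConfig 4 G) (n : ℕ) (y z : Fin 4 → ℤ) (s₀ : ℝ), 0 < s₀ → s₀ ≤ (n : ℝ) * a β →
          n₃ ≤ n → ‖siteToE (y - x) - (n : ℝ) • v‖ ≤ δ * n → ‖siteToE (z - x) - (n : ℝ) • w‖ ≤ δ * n →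
            K₃ s₀ * n ≤ depth (fun j => x j - R) (2 * R + 1) x →
            K₃ s₀ * n ≤ depth (fun j => x j - R) (2 * R + 1) y →
            K₃ s₀ * n ≤ depth (fun j => x j - R) (2 * R + 1) z →
              c₃ * Γ₃ ((n : ℝ) * a β) ≤
                σ * (n : ℝ) ^ 12 * kerK3 G r β (fun j => x j - R) (2 * R + 1) η x y z) :
    LowerBounds G r a :=
  ⟨lowerBounds_twoPoint_weak G r a hapos hlim hFBL hF, lowerBounds_threePoint_weak G r a hapos hlim hFBL hA hT⟩

/-- **The registered `FC2` implies the weak floor clause (F)** (restrict to x-centred cubes, keep the lower half; the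
collar condition at `y` implies the one at the centre `x`, whose depth `R + 1` is maximal). [folklore] -/
theorem floor_of_fc2 (h : FC2 G r a) :
    ∃ (Γ : ℝ → ℝ) (β₂ ℓ₂ c₂ : ℝ) (K : ℝ → ℝ) (n₀ : ℕ), 0 < ℓ₂ ∧ 0 < c₂ ∧ (∀ s, 1 ≤ K s) ∧
      Tendsto (fun s : ℝ => s * K s) (nhdsWithin 0 (Set.Ioi 0)) (nhds 0) ∧ 1 ≤ n₀ ∧
      Tendsto (fun s : ℝ => Γ s / s ^ 8) (nhdsWithin 0 (Set.Ioi 0)) atTop ∧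
      ∀ β : ℝ, β₂ ≤ β → ∀ (x : Fin 4 → ℤ) (R : ℕ), ((2 * R + 1 : ℕ) : ℝ) * a β ≤ ℓ₂ →
        ∀ (η : LGConfig 4 G) (y : Fin 4 → ℤ) (s₀ : ℝ), 0 < s₀ → s₀ ≤ ‖siteToE (y - x)‖ * a β →
          (n₀ : ℝ) ≤ ‖siteToE (y - x)‖ → ‖siteToE (y - x)‖ < 3 * siteToE (y - x) 0 →
            K s₀ * ‖siteToE (y - x)‖ ≤ depth (fun j => x j - R) (2 * R + 1) y →
              c₂ * Γ (‖siteToE (y - x)‖ * a β) ≤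
                ‖siteToE (y - x)‖ ^ 8 *
                  kerCov G r β (fun j => x j - R) (2 * R + 1) η (dens G r x) (dens G r y) := by
  obtain ⟨Γ, β₂, ℓ₂, c₂, C₂, K, n₀, hℓ₂, hc₂, hK1, hKlim, hn₀, -, -, hΓlim, H⟩ := h
  refine ⟨Γ, β₂, ℓ₂, c₂, K, n₀, hℓ₂, hc₂, hK1, hKlim, hn₀, hΓlim, ?_⟩
  intro β hβ x R hb η y s₀ hs₀ hs₀le hn _hcone hKy
  have hyx : (depth (fun j => x j - R) (2 * R + 1) y : ℝ) ≤ depth (fun j => x j - R) (2 * R + 1) x := by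
    have h1 : (depth (fun j => x j - R) (2 * R + 1) y : ℝ) ≤ (R : ℝ) + 1 := by
      exact_mod_cast depth_centred_le x y R
    have h2 : (R : ℝ) + 1 ≤ depth (fun j => x j - R) (2 * R + 1) x := by
      have := le_depth_cube x x R (t := 0) (fun j => by simp)
      linarith
    exact h1.trans h2
  exact (H β hβ _ _ hb η x y s₀ hs₀ hs₀le hn (hKy.trans hyx) hKy).1

/-- **The registered `FC2` implies the sign-free clustering clause (A)** with the constant `max C₂ 0` (the two-sided
sandwich with `0 < Γ ≤ 1` at separations in `(0, ℓ₂]`; x-centred cubes). [folklore] -/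
theorem abs_of_fc2 (h : FC2 G r a) :
    ∃ (β₂ ℓ₂ C₂ : ℝ) (K : ℝ → ℝ) (n₀ : ℕ), 0 < ℓ₂ ∧ (∀ s, 1 ≤ K s) ∧
      Tendsto (fun s : ℝ => s * K s) (nhdsWithin 0 (Set.Ioi 0)) (nhds 0) ∧ 1 ≤ n₀ ∧
      ∀ β : ℝ, β₂ ≤ β → ∀ (x : Fin 4 → ℤ) (R : ℕ), ((2 * R + 1 : ℕ) : ℝ) * a β ≤ ℓ₂ →
        ∀ (η : LGConfig 4 G) (u u' : Fin 4 → ℤ) (s₀ : ℝ), 0 < s₀ → s₀ ≤ ‖siteToE (u' - u)‖ * a β →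
          ‖siteToE (u' - u)‖ * a β ≤ ℓ₂ → (n₀ : ℝ) ≤ ‖siteToE (u' - u)‖ →
            K s₀ * ‖siteToE (u' - u)‖ ≤ depth (fun j => x j - R) (2 * R + 1) u →
            K s₀ * ‖siteToE (u' - u)‖ ≤ depth (fun j => x j - R) (2 * R + 1) u' →
              |‖siteToE (u' - u)‖ ^ 8 *
                  kerCov G r β (fun j => x j - R) (2 * R + 1) η (dens G r u) (dens G r u')| ≤ C₂ := by
  obtain ⟨Γ, β₂, ℓ₂, c₂, C₂, K, n₀, hℓ₂, hc₂, hK1, hKlim, hn₀, -, hΓ, -, H⟩ := h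
  refine ⟨β₂, ℓ₂, max C₂ 0, K, n₀, hℓ₂, hK1, hKlim, hn₀, ?_⟩
  intro β hβ x R hb η u u' s₀ hs₀ hs₀le hle hn hKu hKu'
  obtain ⟨hlow, hup⟩ := H β hβ _ _ hb η u u' s₀ hs₀ hs₀le hn hKu hKu'
  obtain ⟨hΓ0, hΓ1⟩ := hΓ _ (hs₀.trans_le hs₀le) hle
  have hpos : 0 ≤ ‖siteToE (u' - u)‖ ^ 8 *
      kerCov G r β (fun j => x j - R) (2 * R + 1) η (dens G r u) (dens G r u') :=
    le_trans (mul_pos hc₂ hΓ0).le hlow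
  rw [abs_of_nonneg hpos]
  refine hup.trans ?_
  calc C₂ * Γ (‖siteToE (u' - u)‖ * a β) ≤ max C₂ 0 * Γ (‖siteToE (u' - u)‖ * a β) :=
        mul_le_mul_of_nonneg_right (le_max_left _ _) hΓ0.le
    _ ≤ max C₂ 0 * 1 := mul_le_mul_of_nonneg_left hΓ1 (le_max_right _ _)
    _ = max C₂ 0 := mul_one _

/-- **The registered `FC3` implies the weak third-cumulant clause (T)** (x-centred cubes; `1 ≤ n₃`, continuity and
positivity of `Γ₃` dropped). [folklore] -/
theorem fc3Weak_of_fc3 (h : FC3 G r a) :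
    ∃ (v w : EuclideanSpace ℝ (Fin 4)) (σ δ : ℝ) (Γ₃ : ℝ → ℝ) (β₃ ℓ₃ c₃ : ℝ) (K₃ : ℝ → ℝ) (n₃ : ℕ),
      (σ = 1 ∨ σ = -1) ∧ 0 < δ ∧ 2 * δ < ‖v‖ ∧ 2 * δ < ‖w‖ ∧ 2 * δ < ‖v - w‖ ∧ 0 < ℓ₃ ∧ 0 < c₃ ∧
      (∀ s, 1 ≤ K₃ s) ∧ Tendsto (fun s : ℝ => s * K₃ s) (nhdsWithin 0 (Set.Ioi 0)) (nhds 0) ∧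
      Tendsto (fun s : ℝ => Γ₃ s / s ^ 4) (nhdsWithin 0 (Set.Ioi 0)) atTop ∧
      ∀ β : ℝ, β₃ ≤ β → ∀ (x : Fin 4 → ℤ) (R : ℕ), ((2 * R + 1 : ℕ) : ℝ) * a β ≤ ℓ₃ →
        ∀ (η : LGConfig 4 G) (n : ℕ) (y z : Fin 4 → ℤ) (s₀ : ℝ), 0 < s₀ → s₀ ≤ (n : ℝ) * a β →
          n₃ ≤ n → ‖siteToE (y - x) - (n : ℝ) • v‖ ≤ δ * n → ‖siteToE (z - x) - (n : ℝ) • w‖ ≤ δ * n →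
            K₃ s₀ * n ≤ depth (fun j => x j - R) (2 * R + 1) x →
            K₃ s₀ * n ≤ depth (fun j => x j - R) (2 * R + 1) y →
            K₃ s₀ * n ≤ depth (fun j => x j - R) (2 * R + 1) z →
              c₃ * Γ₃ ((n : ℝ) * a β) ≤
                σ * (n : ℝ) ^ 12 * kerK3 G r β (fun j => x j - R) (2 * R + 1) η x y z := by
  obtain ⟨v, w, σ, δ, Γ₃, β₃, ℓ₃, c₃, K₃, n₃, hσ, hδ, hv, hw, hvw, hℓ₃, hc₃, hK1, hKlim, -, -, -, hΓlim, H⟩ := h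
  exact ⟨v, w, σ, δ, Γ₃, β₃, ℓ₃, c₃, K₃, n₃, hσ, hδ, hv, hw, hvw, hℓ₃, hc₃, hK1, hKlim, hΓlim,
    fun β hβ x R hb η n y z s₀ hs₀ hs₀le hn hy hz hKx hKy hKz =>
      H β hβ _ _ hb η n x y z s₀ hs₀ hs₀le hn hy hz hKx hKy hKz⟩

/-- **The body of `CFP` implies the weak package**: for a unit map with the registered conditional femto package
`FBL ∧ FC2 ∧ FC3` the weak clauses (F), (A), (T) hold, hence `LowerBounds` through `lowerBounds_of_weakPackage` — the
registered composition `NT_of` factors through the weak package. [folklore] -/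
theorem lowerBounds_of_cfpBody (hapos : ∀ β, 0 < a β) (hlim : Tendsto a atTop (𝓝 0)) (hFBL : FBL G r a)
    (hFC2 : FC2 G r a) (hFC3 : FC3 G r a) : LowerBounds G r a :=
  lowerBounds_of_weakPackage G r a hapos hlim hFBL (floor_of_fc2 G r a hFC2) (abs_of_fc2 G r a hFC2)
    (fc3Weak_of_fc3 G r a hFC3)

end Lattice

/-- **Crux `NT` BY NAME from the weak package.**  If for every compact simple `G` (Borel σ-algebra) some lattice
representation `r` and some unit map `a` (`0 < a`, `a → 0`) carry the femto boundary law `FBL G r a`, the weak floor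
clause (F) (x-centred femto cubes, lower bound only, forward cone, growth `Γ(s)/s⁸ → ∞`), the sign-free clustering
clause (A) and the weak third-cumulant clause (T), then `Summit.QuantumFields.YangMills.Theses.BalabanLadder.NT`
holds.  Candidate v3 re-cut «weak package» for the owner; strictly fewer engine obligations than the registered
`CFP` (`lowerBounds_of_cfpBody`). [folklore] -/
theorem nt_of_weakPackage
    (h : ∀ (G : Type) [Group G] [TopologicalSpace G] [IsTopologicalGroup G] [CompactSpace G],
      IsCompactSimpleLieGroup G → letI : MeasurableSpace G := borel G; haveI : BorelSpace G := ⟨rfl⟩;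
      ∃ (r : LatticeRep G) (a : ℝ → ℝ), (∀ β, 0 < a β) ∧ Tendsto a atTop (𝓝 0) ∧ FBL G r a ∧
      (∃ (Γ : ℝ → ℝ) (β₂ ℓ₂ c₂ : ℝ) (K : ℝ → ℝ) (n₀ : ℕ), 0 < ℓ₂ ∧ 0 < c₂ ∧ (∀ s, 1 ≤ K s) ∧
        Tendsto (fun s : ℝ => s * K s) (nhdsWithin 0 (Set.Ioi 0)) (nhds 0) ∧ 1 ≤ n₀ ∧
        Tendsto (fun s : ℝ => Γ s / s ^ 8) (nhdsWithin 0 (Set.Ioi 0)) atTop ∧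
        ∀ β : ℝ, β₂ ≤ β → ∀ (x : Fin 4 → ℤ) (R : ℕ), ((2 * R + 1 : ℕ) : ℝ) * a β ≤ ℓ₂ →
          ∀ (η : LGConfig 4 G) (y : Fin 4 → ℤ) (s₀ : ℝ), 0 < s₀ → s₀ ≤ ‖siteToE (y - x)‖ * a β →
            (n₀ : ℝ) ≤ ‖siteToE (y - x)‖ → ‖siteToE (y - x)‖ < 3 * siteToE (y - x) 0 →
              K s₀ * ‖siteToE (y - x)‖ ≤ depth (fun j => x j - R) (2 * R + 1) y →
                c₂ * Γ (‖siteToE (y - x)‖ * a β) ≤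
                  ‖siteToE (y - x)‖ ^ 8 *
                    kerCov G r β (fun j => x j - R) (2 * R + 1) η (dens G r x) (dens G r y)) ∧
      (∃ (β₂ ℓ₂ C₂ : ℝ) (K : ℝ → ℝ) (n₀ : ℕ), 0 < ℓ₂ ∧ (∀ s, 1 ≤ K s) ∧
        Tendsto (fun s : ℝ => s * K s) (nhdsWithin 0 (Set.Ioi 0)) (nhds 0) ∧ 1 ≤ n₀ ∧
        ∀ β : ℝ, β₂ ≤ β → ∀ (x : Fin 4 → ℤ) (R : ℕ), ((2 * R + 1 : ℕ) : ℝ) * a β ≤ ℓ₂ →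
          ∀ (η : LGConfig 4 G) (u u' : Fin 4 → ℤ) (s₀ : ℝ), 0 < s₀ → s₀ ≤ ‖siteToE (u' - u)‖ * a β →
            ‖siteToE (u' - u)‖ * a β ≤ ℓ₂ → (n₀ : ℝ) ≤ ‖siteToE (u' - u)‖ →
              K s₀ * ‖siteToE (u' - u)‖ ≤ depth (fun j => x j - R) (2 * R + 1) u →
              K s₀ * ‖siteToE (u' - u)‖ ≤ depth (fun j => x j - R) (2 * R + 1) u' →
                |‖siteToE (u' - u)‖ ^ 8 *
                    kerCov G r β (fun j => x j - R) (2 * R + 1) η (dens G r u) (dens G r u')| ≤ C₂) ∧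
      (∃ (v w : EuclideanSpace ℝ (Fin 4)) (σ δ : ℝ) (Γ₃ : ℝ → ℝ) (β₃ ℓ₃ c₃ : ℝ) (K₃ : ℝ → ℝ) (n₃ : ℕ),
        (σ = 1 ∨ σ = -1) ∧ 0 < δ ∧ 2 * δ < ‖v‖ ∧ 2 * δ < ‖w‖ ∧ 2 * δ < ‖v - w‖ ∧ 0 < ℓ₃ ∧ 0 < c₃ ∧
        (∀ s, 1 ≤ K₃ s) ∧ Tendsto (fun s : ℝ => s * K₃ s) (nhdsWithin 0 (Set.Ioi 0)) (nhds 0) ∧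
        Tendsto (fun s : ℝ => Γ₃ s / s ^ 4) (nhdsWithin 0 (Set.Ioi 0)) atTop ∧
        ∀ β : ℝ, β₃ ≤ β → ∀ (x : Fin 4 → ℤ) (R : ℕ), ((2 * R + 1 : ℕ) : ℝ) * a β ≤ ℓ₃ →
          ∀ (η : LGConfig 4 G) (n : ℕ) (y z : Fin 4 → ℤ) (s₀ : ℝ), 0 < s₀ → s₀ ≤ (n : ℝ) * a β →
            n₃ ≤ n → ‖siteToE (y - x) - (n : ℝ) • v‖ ≤ δ * n → ‖siteToE (z - x) - (n : ℝ) • w‖ ≤ δ * n →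
              K₃ s₀ * n ≤ depth (fun j => x j - R) (2 * R + 1) x →
              K₃ s₀ * n ≤ depth (fun j => x j - R) (2 * R + 1) y →
              K₃ s₀ * n ≤ depth (fun j => x j - R) (2 * R + 1) z →
                c₃ * Γ₃ ((n : ℝ) * a β) ≤
                  σ * (n : ℝ) ^ 12 * kerK3 G r β (fun j => x j - R) (2 * R + 1) η x y z)) :
    Summit.QuantumFields.YangMills.Theses.BalabanLadder.NT := by
  intro G _ _ _ _ hG
  letI : MeasurableSpace G := borel G
  haveI : BorelSpace G := ⟨rfl⟩
  obtain ⟨r, a, ha, ha0, hfbl, hF, hA, hT⟩ := h G hG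
  exact ⟨r, a, ha, ha0, lowerBounds_of_weakPackage G r a ha ha0 hfbl hF hA hT⟩

/-- **Crux `NT` BY NAME from the INHERITED package of crux `OSLegsAtWeakCouplingC`** (stmt-QuantumFields-16207, line
`inherited-amplitude-gates`): if for every compact simple `G` some `(r, a)` (`0 < a`, `a → 0`) carries
`FBL G r a ∧ FC2I G r a ∧ FC3 G r a` — `FC2I` = sign-free hyperscaling bound (U) + windowed floor (L), no shape function,
no growth clause — then `BalabanLadder.NT` holds (landed `stub_lowerI`). [folklore] -/
theorem nt_of_inheritedPackage
    (h : ∀ (G : Type) [Group G] [TopologicalSpace G] [IsTopologicalGroup G] [CompactSpace G],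
      IsCompactSimpleLieGroup G → letI : MeasurableSpace G := borel G; haveI : BorelSpace G := ⟨rfl⟩;
      ∃ (r : LatticeRep G) (a : ℝ → ℝ), (∀ β, 0 < a β) ∧ Tendsto a atTop (𝓝 0) ∧
        FBL G r a ∧ FC2I G r a ∧ FC3 G r a) :
    Summit.QuantumFields.YangMills.Theses.BalabanLadder.NT := by
  intro G _ _ _ _ hG
  letI : MeasurableSpace G := borel G
  haveI : BorelSpace G := ⟨rfl⟩
  obtain ⟨r, a, ha, ha0, hfbl, hI, h3⟩ := h G hG
  exact ⟨r, a, ha, ha0, stub_lowerI G r a ha ha0 hfbl hI h3⟩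

end Summit.QuantumFields.YangMills.Cruxes.NT.WeakPackage

end
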